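import Literature.Computability.Complexity.Promise
import Literature.Computability.Complexity.CoinCounting
import HarnessLib

/-!
# Complexity core: the textbook promise classes promise-RP, promise-coRP and promise-ZPP

Topic `Literature/Computability/Complexity` (trunk `CplxCore`), companion to `Promise.lean`, which
defines promise problems, the lift `promiseLift C` and the *textbook* promise-BPP `PromiseBPP'`
(acceptance gap required on the promise only). This file adds, in exactly the same normal form
(a witness language `L' ∈ P` read on `boolPair x y` with coin strings `y` of the exact polynomial
length `p |x|`, probabilities by `uniformProb`), the one-sided and zero-error classes:

* `PromiseRP'` — Goldreich's promise-`RP`: on a yes-instance at least half of the coin strings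
  accept, on a no-instance none does; nothing is required off the promise
  [Goldreich 2006, §6.2; for languages Arora–Barak 2009, Def. 7.6, Gill 1977, Def. 5.1];
* `PromiseCoRP' = {Q | Q.swap ∈ PromiseRP'}` — promise-`coRP` [Goldreich 2006, §6.2];
* `PromiseZPP' = PromiseRP' ∩ PromiseCoRP'` — promise-`ZPP`, *theorem-as-definition* exactly as
  the tree's `ZPP := RP ∩ coRP` (`ProbabilisticClasses.lean`; Gill 1977, Thm. 5.2(ii)): a
  promise problem has a zero-error randomized polynomial-time algorithm answering `⊥` with
  probability `≤ 1/2` on the promise iff it lies in both one-sided classes (run both machines).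
  This is the class `Promise-ZPP` of Hirahara (FOCS 2018, Fact 3.8 / Cor. 4.22), needed to state
  his worst-case-to-average-case reduction for `Gap MINKT` faithfully
  (`Literature/Computability/MetaComplexity/GapMINKT.lean`).

API (all proved): unfolding lemmas; on trivial promises the classes are the language classes
(`ofLanguage_mem_PromiseRP'_iff : ofLanguage L ∈ PromiseRP' ↔ L ∈ RP`, likewise `coRP`, `ZPP`);
`swap` exchanges `PromiseRP'` and `PromiseCoRP'` and preserves `PromiseZPP'`; restricting the
promise preserves membership (`PromiseRP'.anti` etc., Goldreich 2006, §6.1: "any solver of a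
problem also solves its special cases"); members are disjoint promise problems
(`PromiseProblem.Disjoint.of_mem_PromiseRP'`: a yes-instance has an accepting coin string, a
no-instance has none); Goldreich's form of promise-`coRP` with an always-accepting witness
(`mem_PromiseCoRP'_iff_forall`, via `co P = P`). The inclusions `PromiseP ⊆ PromiseZPP' ⊆ PromiseBPP'`
(two independent runs, Arora–Barak §7.3) need machine plumbing and are proved in the sibling
`PromiseZPPProofs.lean`.

## Design notes

* Primed names follow `PromiseBPP'`: the unprimed `promiseLift RP`, `promiseLift ZPP` would be the
  *strong* classes demanding the one-sided/zero-error behaviour on all inputs (cf. the caveat on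
  `PromiseBPP` in `Promise.lean`); Hirahara's and Goldreich's `Promise-ZPP`/`Promise-RP` are the
  textbook (primed) ones.
* Constants: success probability `≥ 1/2` on yes-instances as in `rp` (`ProbabilisticClasses.lean`)
  and Goldreich/Arora–Barak; any constant in `(0,1)` gives the same class by repetition.
* As for `rp`, only coin strings of the exact length `p |x|` matter (those sampled by
  `uniformProb (p |x|)`); the "no false positives" clause quantifies over exactly these.
* Mathlib has no promise problems or probabilistic classes (searched `PromiseProblem`, `ZPP`,
  `RP`): nothing is duplicated; the tree had only `PromiseBPP'` (searched `PromiseRP`, `PromiseZPP`).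

## References

* O. Goldreich, *On promise problems: a survey*, in: Theoretical Computer Science — Essays in
  Memory of Shimon Even, LNCS 3895 (2006), 254–290: Def. 2 (§1.2: promise-P/NP/BPP), §6.1
  (special cases), §6.2 (promise-RP and promise-coRP: "Π ∈ RP (resp. coRP) if there is a PPT `A`
  with `Pr[A(x)=1] ≥ 1/2` (resp. `= 1`) for `x ∈ Π_YES` and `Pr[A(x)=0] = 1` (resp. `≥ 1/2`) for
  `x ∈ Π_NO`").
* J. Gill, *Computational complexity of probabilistic Turing machines*, SIAM J. Comput. 6 (1977),
  Def. 5.1–5.2, Thm. 5.2(ii) (`ZPP = RP ∩ coRP`).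
* S. Arora, B. Barak, *Computational Complexity: A Modern Approach*, CUP 2009, Def. 7.6–7.7,
  Thm. 7.8, §7.3.
* S. Hirahara, *Non-black-box worst-case to average-case reductions within NP*, FOCS 2018 /
  ECCC TR18-138 rev. 1, §3 ("for a complexity class C such as ZPP and BPP, we denote by Promise-C
  the promise version of C"), Fact 3.8.
-/

namespace Literature.Computability.Complexity

open _root_.Computability

/-! ### The classes -/

/-- `PromiseRP'`: the textbook class promise-`RP` (one-sided error, gap on the promise only).
`Q ∈ PromiseRP'` iff there are `L' ∈ P` and a polynomial `p` such that on every yes-instance `x`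
at least half of the coin strings `y` of length `p |x|` have `boolPair x y ∈ L'`, and on every
no-instance `x` no coin string `y` of length `p |x|` has `boolPair x y ∈ L'`; nothing is required
off the promise. On trivial promises this is `RP = rp P` (`ofLanguage_mem_PromiseRP'_iff`).
[cite: Goldreich2006, §6.2 (promise RP and coRP)] -/
noncomputable def PromiseRP' : Set PromiseProblem :=
  {Q | ∃ L' ∈ Classes.P, ∃ p : Polynomial ℕ,
    (∀ x ∈ Q.yes, 1 / 2 ≤ uniformProb (p.eval x.length) {y : List Bool | boolPair x y ∈ L'}) ∧
    (∀ x ∈ Q.no, ∀ y : List Bool, y.length = p.eval x.length → boolPair x y ∉ L')}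

/-- `PromiseCoRP'`: the textbook class promise-`coRP`, i.e. the promise problems whose `swap`
(yes and no exchanged) lies in `PromiseRP'`: some `L' ∈ P` rejects (witnesses "no" for) at least
half of the coin strings on every no-instance and none on a yes-instance. Goldreich's equivalent
form with an always-accepting machine is `mem_PromiseCoRP'_iff_forall`.
[cite: Goldreich2006, §6.2 (promise RP and coRP)] -/
noncomputable def PromiseCoRP' : Set PromiseProblem :=
  {Q | Q.swap ∈ PromiseRP'}

/-- `PromiseZPP'`: the textbook class promise-`ZPP`, defined as `PromiseRP' ∩ PromiseCoRP'`
(theorem-as-definition, exactly as the tree's `ZPP := RP ∩ coRP`, Gill's Thm. 5.2(ii): a promise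
problem admits a zero-error randomized polynomial-time algorithm that answers `⊥` with
probability `≤ 1/2` and never errs *on the promise* iff it has both one-sided algorithms). This is
Hirahara's `Promise-ZPP` (FOCS 2018, §3 and Fact 3.8). On trivial promises it is `ZPP`
(`ofLanguage_mem_PromiseZPP'_iff`). [cite: Gill1977, Def. 5.2 and Thm. 5.2(ii)] -/
noncomputable def PromiseZPP' : Set PromiseProblem :=
  PromiseRP' ∩ PromiseCoRP'

/-! ### Unfolding -/

/-- Unfolding lemma for `PromiseRP'`. [cite: Goldreich2006, §6.2] -/
theorem mem_PromiseRP'_iff {Q : PromiseProblem} :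
    Q ∈ PromiseRP' ↔ ∃ L' ∈ Classes.P, ∃ p : Polynomial ℕ,
      (∀ x ∈ Q.yes, 1 / 2 ≤ uniformProb (p.eval x.length) {y : List Bool | boolPair x y ∈ L'}) ∧
      (∀ x ∈ Q.no, ∀ y : List Bool, y.length = p.eval x.length → boolPair x y ∉ L') :=
  Iff.rfl

/-- Unfolding lemma for `PromiseCoRP'`: membership of the swapped problem in `PromiseRP'`.
[cite: Goldreich2006, §6.2] -/
theorem mem_PromiseCoRP'_iff {Q : PromiseProblem} : Q ∈ PromiseCoRP' ↔ Q.swap ∈ PromiseRP' :=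
  Iff.rfl

/-- Unfolding lemma for `PromiseZPP'`. [cite: Gill1977, Thm. 5.2(ii)] -/
theorem mem_PromiseZPP'_iff {Q : PromiseProblem} :
    Q ∈ PromiseZPP' ↔ Q ∈ PromiseRP' ∧ Q ∈ PromiseCoRP' :=
  Iff.rfl

/-- `PromiseZPP' ⊆ PromiseRP'`. [cite: Gill1977, Thm. 5.2(ii)] -/
theorem PromiseZPP'_subset_PromiseRP' : PromiseZPP' ⊆ PromiseRP' := fun _ h => h.1

/-- `PromiseZPP' ⊆ PromiseCoRP'`. [cite: Gill1977, Thm. 5.2(ii)] -/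
theorem PromiseZPP'_subset_PromiseCoRP' : PromiseZPP' ⊆ PromiseCoRP' := fun _ h => h.2

/-- Goldreich's form of promise-`coRP`: `Q ∈ PromiseCoRP'` iff some `L'' ∈ P` accepts *every*
coin string of length `p |x|` on yes-instances and rejects at least half of them on no-instances
(`Pr[A(x)=1] = 1` on `Π_YES`, `Pr[A(x)=0] ≥ 1/2` on `Π_NO`). From the definition by complementing
the witness language (`co P = P`, `compl_mem_P_iff`). [cite: Goldreich2006, §6.2 (promise RP and coRP)] -/
theorem mem_PromiseCoRP'_iff_forall {Q : PromiseProblem} :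
    Q ∈ PromiseCoRP' ↔ ∃ L'' ∈ Classes.P, ∃ p : Polynomial ℕ,
      (∀ x ∈ Q.yes, ∀ y : List Bool, y.length = p.eval x.length → boolPair x y ∈ L'') ∧
      (∀ x ∈ Q.no, 1 / 2 ≤ uniformProb (p.eval x.length) {y : List Bool | boolPair x y ∉ L''}) := by
  have hset : ∀ (L : Language Bool) (x : List Bool),
      {y : List Bool | boolPair x y ∉ Lᶜ} = {y : List Bool | boolPair x y ∈ L} := fun L x => by
    ext y
    change ¬ ¬ boolPair x y ∈ L ↔ boolPair x y ∈ L
    exact not_not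
  constructor
  · rintro ⟨L', hL', p, hyes, hno⟩
    refine ⟨L'ᶜ, compl_mem_P_iff.2 hL', p, fun x hx y hy => ?_, fun x hx => ?_⟩
    · exact hno x hx y hy
    · rw [hset]; exact hyes x hx
  · rintro ⟨L'', hL'', p, hyes, hno⟩
    refine ⟨L''ᶜ, compl_mem_P_iff.2 hL'', p, fun x hx => ?_, fun x hx y hy => ?_⟩
    · change 1 / 2 ≤ uniformProb (p.eval x.length) {y : List Bool | boolPair x y ∈ L''ᶜ}
      exact hno x hx
    · exact fun h => h (hyes x hx y hy)

/-! ### Swap -/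

/-- `swap` sends `PromiseCoRP'` to `PromiseRP'` (definitional). [cite: Goldreich2006, §6.2] -/
@[simp] theorem swap_mem_PromiseRP'_iff {Q : PromiseProblem} :
    Q.swap ∈ PromiseRP' ↔ Q ∈ PromiseCoRP' :=
  Iff.rfl

/-- `swap` sends `PromiseRP'` to `PromiseCoRP'` (`swap` is an involution). [cite: Goldreich2006, §6.2] -/
@[simp] theorem swap_mem_PromiseCoRP'_iff {Q : PromiseProblem} :
    Q.swap ∈ PromiseCoRP' ↔ Q ∈ PromiseRP' := by
  rw [mem_PromiseCoRP'_iff, PromiseProblem.swap_swap]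

/-- `PromiseZPP'` is invariant under `swap` (it is symmetric in yes/no).
[cite: Gill1977, Thm. 5.2(ii)] -/
@[simp] theorem swap_mem_PromiseZPP'_iff {Q : PromiseProblem} :
    Q.swap ∈ PromiseZPP' ↔ Q ∈ PromiseZPP' := by
  rw [mem_PromiseZPP'_iff, mem_PromiseZPP'_iff, swap_mem_PromiseRP'_iff, swap_mem_PromiseCoRP'_iff,
    and_comm]

/-! ### Trivial promises: the language classes -/

/-- On a language (trivial promise) promise-`RP` is `RP`: `ofLanguage L ∈ PromiseRP' ↔ L ∈ RP`
(the two clauses of `rp P` are the yes/no clauses for `⟨L, Lᶜ⟩`). [cite: Goldreich2006, §6.2] -/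
@[simp] theorem ofLanguage_mem_PromiseRP'_iff {L : Language Bool} :
    PromiseProblem.ofLanguage L ∈ PromiseRP' ↔ L ∈ RP := by
  constructor
  · rintro ⟨L', hL', p, hyes, hno⟩
    exact ⟨L', hL', p, fun x => ⟨fun hx => hyes x hx, fun hx => hno x hx⟩⟩
  · rintro ⟨L', hL', p, h⟩
    exact ⟨L', hL', p, fun x hx => (h x).1 hx, fun x hx => (h x).2 hx⟩

/-- On a language promise-`coRP` is `coRP = co RP`: `ofLanguage L ∈ PromiseCoRP' ↔ L ∈ coRP`
(`(ofLanguage L).swap = ofLanguage Lᶜ`). [cite: Goldreich2006, §6.2] -/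
@[simp] theorem ofLanguage_mem_PromiseCoRP'_iff {L : Language Bool} :
    PromiseProblem.ofLanguage L ∈ PromiseCoRP' ↔ L ∈ coRP := by
  rw [mem_PromiseCoRP'_iff, PromiseProblem.swap_ofLanguage, ofLanguage_mem_PromiseRP'_iff]
  rfl

/-- On a language promise-`ZPP` is `ZPP = RP ∩ coRP`: `ofLanguage L ∈ PromiseZPP' ↔ L ∈ ZPP`.
[cite: Gill1977, Thm. 5.2(ii)] -/
@[simp] theorem ofLanguage_mem_PromiseZPP'_iff {L : Language Bool} :
    PromiseProblem.ofLanguage L ∈ PromiseZPP' ↔ L ∈ ZPP := by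
  rw [mem_PromiseZPP'_iff, ofLanguage_mem_PromiseRP'_iff, ofLanguage_mem_PromiseCoRP'_iff]
  rfl

/-! ### Restricting the promise -/

/-- A solver of a promise problem solves its special cases: if `Q'.yes ⊆ Q.yes` and
`Q'.no ⊆ Q.no` then `Q ∈ PromiseRP' → Q' ∈ PromiseRP'` (same witness language and polynomial).
[cite: Goldreich2006, §6.1 (any solver also solves the special cases)] -/
theorem PromiseRP'.anti {Q Q' : PromiseProblem} (hyes : Q'.yes ≤ Q.yes) (hno : Q'.no ≤ Q.no)
    (h : Q ∈ PromiseRP') : Q' ∈ PromiseRP' := by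
  obtain ⟨L', hL', p, hy, hn⟩ := h
  exact ⟨L', hL', p, fun x hx => hy x (hyes hx), fun x hx => hn x (hno hx)⟩

/-- Special cases of promise-`coRP` problems are promise-`coRP`. [cite: Goldreich2006, §6.1] -/
theorem PromiseCoRP'.anti {Q Q' : PromiseProblem} (hyes : Q'.yes ≤ Q.yes) (hno : Q'.no ≤ Q.no)
    (h : Q ∈ PromiseCoRP') : Q' ∈ PromiseCoRP' :=
  PromiseRP'.anti (Q := Q.swap) (Q' := Q'.swap) hno hyes h

/-- Special cases of promise-`ZPP` problems are promise-`ZPP`. [cite: Goldreich2006, §6.1] -/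
theorem PromiseZPP'.anti {Q Q' : PromiseProblem} (hyes : Q'.yes ≤ Q.yes) (hno : Q'.no ≤ Q.no)
    (h : Q ∈ PromiseZPP') : Q' ∈ PromiseZPP' :=
  ⟨PromiseRP'.anti hyes hno h.1, PromiseCoRP'.anti hyes hno h.2⟩

/-! ### Disjointness -/

/-- A promise problem in `PromiseRP'` is disjoint: a yes-instance `x` has acceptance probability
`≥ 1/2 > 0`, hence some accepting coin string of length `p |x|` (`cnt_pos_iff`), while a
no-instance has none. [cite: Goldreich2006, §6.2] -/
theorem PromiseProblem.Disjoint.of_mem_PromiseRP' {Q : PromiseProblem} (h : Q ∈ PromiseRP') :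
    Q.Disjoint := by
  obtain ⟨L', -, p, hyes, hno⟩ := h
  refine Set.disjoint_left.2 fun x hx hx' => ?_
  have hpos : 0 < uniformProb (p.eval x.length) {y : List Bool | boolPair x y ∈ L'} :=
    lt_of_lt_of_le (by norm_num) (hyes x hx)
  rw [uniformProb_eq_cnt_div] at hpos
  have hcnt : 0 < cnt (p.eval x.length) {y : List Bool | boolPair x y ∈ L'} := by
    by_contra h0
    have h0' : cnt (p.eval x.length) {y : List Bool | boolPair x y ∈ L'} = 0 := by omega
    rw [h0'] at hpos
    simp at hpos
  obtain ⟨y, hy, hyL⟩ := (cnt_pos_iff _ _).1 hcnt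
  exact hno x hx' y hy hyL

/-- A promise problem in `PromiseCoRP'` is disjoint. [cite: Goldreich2006, §6.2] -/
theorem PromiseProblem.Disjoint.of_mem_PromiseCoRP' {Q : PromiseProblem} (h : Q ∈ PromiseCoRP') :
    Q.Disjoint := by
  have h' : Q.swap.Disjoint := PromiseProblem.Disjoint.of_mem_PromiseRP' h
  simpa using h'.swap

/-- A promise problem in `PromiseZPP'` is disjoint. [cite: Gill1977, Thm. 5.2(ii)] -/
theorem PromiseProblem.Disjoint.of_mem_PromiseZPP' {Q : PromiseProblem} (h : Q ∈ PromiseZPP') :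
    Q.Disjoint :=
  PromiseProblem.Disjoint.of_mem_PromiseRP' h.1

end Literature.Computability.Complexity
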